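import Summits.QuantumFields.YangMills.Theorems.IR.VacuumEscapePhysicalTimeArith
import Summits.QuantumFields.YangMills.Theorems.IR.VacuumEscapeRungStrongCouplingSlice
import HarnessLib

/-!
# Line `vacuum_escape` (crux `BalabanLadder.IR`, stmt-QuantumFields-19354) — physical-time currency, part 4a:
# the variational direction on one torus

One-torus form of `SliceGapInUnits ⇒ PhysicalTimeConductance` (census B6; pooled prover ym-ir-line-pool-p3): a rate bound `x_{m+2} ≤ X e^{−c(m+2)}`
on the trace excesses of the spatial torus `(2S+1)³` gives, for every measurable slice event `A` and every `k < 1 − e^{−c n}`,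
`k · mass_m(A)(1 − mass_m(A)) ≤ mass_m(A) − stay_m^{(n)}(A)` for all large temporal extents (`lagConductance_eventually_of_traceExcess_le`).
Proof: the trace bound forces `λᵢ/λ₀ ≤ e^{−c}` off the vacuum; the tree's variational Parseval bound `setIntegral_kernel_le_of_gap` applied to the
iterated kernel `K⁽ⁿ⁾` (part 1) and the operator `Aⁿ` gives `Qₙ ≤ ϑⁿ P + (1 − ϑⁿ) P²` (`ϑ = e^{−c}`, `P = π(A)`), i.e. `P − Qₙ ≥ (1 − e^{−cn}) P (1 − P)`;
the finite-`m` slice-chain probabilities converge to `P, Qₙ` (part 2, 3b) and the strict margin — or the Haar-null degenerate cases `P ∈ {0,1}` —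
gives the inequality eventually.  [Lawler–Sokal 1988 (2.18); Osterwalder–Seiler 1978 §3]

HONEST FRAMING: a format equivalence between two typed currencies of ONE line of an open crux of a CONDITIONAL chain; the content of the line
(the LOAD `stub_noStickySliceEvent`, weak-coupling volume-uniform isoperimetry) is untouched; nothing here proves `BalabanLadder.IR`, a lattice
gap, or the Yang–Mills mass gap (Clay); R4 of the ladder closes only `BalabanLadder.UV`.
-/

set_option autoImplicit false

noncomputable section

open MeasureTheory Filter Set Function
open scoped RealInnerProductSpace ENNReal Topology
open Literature.Analysis.OperatorTheory Literature.MathematicalPhysics.QuantumFieldTheory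
open Literature.MathematicalPhysics.QuantumFieldTheory.Balaban1983to89.Missing (cyclicPartition_pos_of_unitary)
open Summit.QuantumFields.YangMills.Cruxes.IR.VacuumEscape.Spectral Summit.QuantumFields.YangMills.Cruxes.IR.VacuumEscape.GroundState
open Summit.QuantumFields.YangMills.Cruxes.IR.VacuumEscape.IterKernel Summit.QuantumFields.YangMills.Cruxes.IR.VacuumEscape.LagSpectral

namespace Summit.QuantumFields.YangMills.Cruxes.IR.VacuumEscape

section PerTorus

variable {G : Type} [Group G] [TopologicalSpace G] [IsTopologicalGroup G] [CompactSpace G] [MeasurableSpace G] [BorelSpace G]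
  [SecondCountableTopology G] {n : ℕ} {ρ : G →* Matrix (Fin n) (Fin n) ℂ}

set_option maxHeartbeats 800000 in
-- one long bookkeeping proof (spectral limits + three cases); the default heartbeat budget runs out in the limit block
/-- **The variational direction on one torus** (`n = r + 1` steps).  For continuous unitary `ρ`, `β ≥ 0`, a spatial torus `(2S+1)³`, a rate `c`
with `x_{m+2} ≤ X e^{−c(m+2)}` for all `m`, a measurable slice event `A` and any `k < 1 − e^{−c(r+1)}`:
`k · mass_m(A)(1 − mass_m(A)) ≤ mass_m(A) − stay_m^{(r+1)}(A)` for all large temporal extents `m + 2`. -/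
theorem lagConductance_eventually_of_traceExcess_le (hρ : Continuous ρ) (hρu : ∀ g, ρ g ∈ Matrix.unitaryGroup (Fin n) ℂ)
    {β : ℝ} (hβ : 0 ≤ β) (S : ℕ) (r : ℕ) {c Xc : ℝ}
    (hx : ∀ m : ℕ, traceExcess ρ β (2 * S + 1) (m + 2) ≤ Xc * Real.exp (-(c * ((m + 2 : ℕ) : ℝ))))
    {k : ℝ} (hklt : k < 1 - Real.exp (-(c * ((r : ℝ) + 1))))
    (Aset : Set (GaugeConfig 3 (2 * S + 1) G)) (hAset : MeasurableSet Aset) :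
    ∃ m₀ : ℕ, ∀ m : ℕ, m₀ ≤ m →
      k * (sliceMass ρ β (2 * S + 1) (m + 2) Aset * (1 - sliceMass ρ β (2 * S + 1) (m + 2) Aset)) ≤
        sliceMass ρ β (2 * S + 1) (m + 2) Aset - sliceStayN ρ β (2 * S + 1) (m + 2) (r + 1) Aset := by
  classical
  set μ : Measure (GaugeConfig 3 (2 * S + 1) G) := Measure.pi fun _ : Edge 3 (2 * S + 1) => haarProbability G with hμ
  set K : GaugeConfig 3 (2 * S + 1) G → GaugeConfig 3 (2 * S + 1) G → ℝ := wilsonSliceKernel ρ β with hKdef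
  set A := wilsonTorusTransferMatrix ρ β (2 * S + 1) with hAdef
  -- kernel facts
  have hK : StronglyMeasurable (uncurry K) := stronglyMeasurable_uncurry_wilsonSliceKernel ρ hρ β
  have hKm : Measurable (uncurry K) := hK.measurable
  obtain ⟨C, hC⟩ := exists_norm_wilsonSliceKernel_le (L := (2 * S + 1)) ρ hρ β
  have hsymm : ∀ x y, K x y = K y x := wilsonSliceKernel_symm ρ hρu β
  have hpos : ∀ x y, 0 < K x y := wilsonSliceKernel_pos ρ hρ β
  obtain ⟨κ₀, hκ₀, hKmin⟩ : ∃ κ₀ : ℝ, 0 < κ₀ ∧ ∀ U U' : GaugeConfig 3 (2 * S + 1) G, κ₀ ≤ K U U' := by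
    have hcont := continuous_uncurry_wilsonSliceKernel (L := (2 * S + 1)) ρ hρ β
    obtain ⟨p, -, hp⟩ := isCompact_univ.exists_isMinOn univ_nonempty hcont.continuousOn
    exact ⟨K p.1 p.2, hpos p.1 p.2, fun U U' => (isMinOn_iff.mp hp) (U, U') (mem_univ _)⟩
  have hAker : ∀ φ : Lp ℝ 2 μ, (A φ : GaugeConfig 3 (2 * S + 1) G → ℝ) =ᵐ[μ] fun U => ∫ U', K U U' * φ U' ∂μ :=
    wilsonTorusTransferMatrix_ae_eq β (2 * S + 1) hρ
  have hsa : IsSelfAdjoint A := isSelfAdjoint_wilsonTorusTransferMatrix (2 * S + 1) hρ hρu β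
  have hcpt : IsCompactOperator A := isCompactOperator_wilsonTorusTransferMatrix β (2 * S + 1) hρ
  have himp : IsPositivityImproving A := isPositivityImproving_wilsonTorusTransferMatrix β (2 * S + 1) hρ
  have hA0 : A ≠ 0 := wilsonTorusTransferMatrix_ne_zero β (2 * S + 1) hρ
  -- the iterated kernels
  set Kn : ℕ → GaugeConfig 3 (2 * S + 1) G → GaugeConfig 3 (2 * S + 1) G → ℝ :=
    fun j x y => (fun f : GaugeConfig 3 (2 * S + 1) G → ℝ => fun w => ∫ z, K w z * f z ∂μ)^[j] (fun z => K z y) x with hKn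
  have hK0 : Kn 0 = K := rfl
  have hKs : ∀ j x y, Kn (j + 1) x y = ∫ z, K x z * Kn j z y ∂μ := by
    intro j x y
    simp only [hKn, Function.iterate_succ_apply']
  have hAkern : ∀ φ : Lp ℝ 2 μ, ((A ^ (r + 1)) φ : GaugeConfig 3 (2 * S + 1) G → ℝ) =ᵐ[μ] fun U => ∫ U', Kn r U U' * φ U' ∂μ :=
    pow_opKernel (μ := μ) hKm hC hK0 hKs hAker r
  have hsan : IsSelfAdjoint (A ^ (r + 1)) := hsa.pow (r + 1)
  -- spectral data and ground state
  obtain ⟨s, hs, b, lam, i₀, hb, hle, hL0, hi₀, hS2, hrad, hZ⟩ :=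
    exists_spectralData_wilsonTorusTransferMatrix (2 * S + 1) hρ hρu hβ
  haveI : Countable s := hs
  have hlam0 : ∀ i, 0 ≤ lam i := fun i => (hle i).1
  obtain ⟨h, B, h₀, θ, hhm, hhB, hh₀, hlow, heig, hnorm, ⟨ε, hε2, hbε⟩, horth, hθ0, hθ, hgapl⟩ :=
    exists_groundState_data (μ := μ) hK hC hsymm hpos hκ₀ hKmin hAker hsa hcpt himp hA0 hb hlam0 hi₀
  set lam₀ : ℝ := lam i₀ with hlam₀def
  set rr : s → ℝ := fun i => lam i / lam₀ with hr
  have hr0 : ∀ i, 0 ≤ rr i := fun i => div_nonneg (hlam0 i) hL0.le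
  have hri₀ : rr i₀ = 1 := div_self hL0.ne'
  set ϑ : ℝ := θ / lam₀ with hϑ
  have hϑ1 : ϑ < 1 := (div_lt_one hL0).2 hθ
  have hrϑ : ∀ i, i ≠ i₀ → rr i ≤ ϑ := fun i hi => div_le_div_of_nonneg_right (hgapl i hi) hL0.le
  have hrsum : Summable fun i => rr i ^ 2 := by
    have := hS2.div_const (lam₀ ^ 2)
    refine this.congr fun i => ?_
    rw [hr]; simp only; rw [div_pow]
  have hlam_eq : ∀ i (j : ℕ), lam i ^ j = lam₀ ^ j * rr i ^ j := fun i j => by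
    rw [← mul_pow, hr]; simp only; rw [mul_div_cancel₀ _ hL0.ne']
  have hlamr : ∀ i, lam i = lam₀ * rr i := fun i => by rw [hr]; simp only; rw [mul_div_cancel₀ _ hL0.ne']
  have hL0n : 0 < lam₀ ^ (r + 1) := pow_pos hL0 _
  -- (0) the gap from the trace-excess bound: `λᵢ/λ₀ ≤ e^{−c}` off the top
  have htr : ∀ m : ℕ, traceExcess ρ β (2 * S + 1) (m + 2) = ∑' i, (if i = i₀ then 0 else rr i ^ (m + 2)) := by
    intro m
    have h1 : HasSum (fun i => rr i ^ (m + 2)) (cyclicPartition ρ β (2 * S + 1) (m + 2) / lam₀ ^ (m + 2)) := by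
      have := (hZ m).div_const (lam₀ ^ (m + 2))
      refine this.congr_fun fun i => ?_
      rw [hlam_eq i (m + 2), mul_div_cancel_left₀ _ (pow_ne_zero _ hL0.ne')]
    have hsumm : Summable fun i => rr i ^ (m + 2) := h1.summable
    unfold traceExcess
    rw [hrad, ← h1.tsum_eq, hsumm.tsum_eq_add_tsum_ite i₀, hri₀, one_pow]
    ring
  set ee : ℝ := Real.exp (-c) with hee
  have hee0 : 0 < ee := Real.exp_pos _
  have hre : ∀ i, i ≠ i₀ → rr i ≤ ee := by
    intro i hi
    refine le_of_pow_le_mul_pow hee0 (X := Xc) fun m => ?_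
    have hsumm : Summable fun j => (if j = i₀ then 0 else rr j ^ (m + 2)) := by
      refine Summable.of_nonneg_of_le (fun j => ?_) (fun j => ?_) ((hrsum.mul_right (1 : ℝ)))
      · split_ifs
        · exact le_rfl
        · exact pow_nonneg (hr0 j) _
      · split_ifs with hj
        · rw [mul_one]; exact sq_nonneg _
        · rw [mul_one, pow_add]
          have hj1 : rr j ≤ 1 := (hrϑ j hj).trans hϑ1.le
          calc rr j ^ m * rr j ^ 2 ≤ 1 * rr j ^ 2 :=
                mul_le_mul_of_nonneg_right (pow_le_one₀ (hr0 j) hj1) (sq_nonneg _)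
            _ = rr j ^ 2 := one_mul _
    have h1 : rr i ^ (m + 2) ≤ traceExcess ρ β (2 * S + 1) (m + 2) := by
      rw [htr m]
      have := hsumm.le_tsum i (fun j _ => by
        split_ifs
        · exact le_rfl
        · exact pow_nonneg (hr0 j) _)
      simpa [hi] using this
    have hem : ee ^ (m + 2) = Real.exp (-(c * ((m + 2 : ℕ) : ℝ))) := by
      rw [hee, ← Real.exp_nat_mul]; congr 1; push_cast; ring
    rw [hem]
    exact h1.trans (hx m)
  -- the `(r+1)`-step gap and the variational Parseval bound
  have hgapn : ∀ i, i ≠ i₀ → lam i ^ (r + 1) ≤ ee ^ (r + 1) * lam₀ ^ (r + 1) := by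
    intro i hi
    rw [hlam_eq i (r + 1), mul_comm]
    exact mul_le_mul_of_nonneg_right (pow_le_pow_left₀ (hr0 i) (hre i hi) _) hL0n.le
  have hvar := setIntegral_kernel_le_of_gap (μ := μ) hAkern hsan (fun i => pow_apply_basis hb (r + 1) i) (i₀ := i₀)
    (lam1 := ee ^ (r + 1) * lam₀ ^ (r + 1)) hgapn hhm hhB hε2 hbε hAset
  have hcond0 : (1 - ee ^ (r + 1)) * (∫ x in Aset, h x ^ 2 ∂μ) * (1 - ∫ x in Aset, h x ^ 2 ∂μ) ≤
      (∫ x in Aset, h x ^ 2 ∂μ) - (lam₀ ^ (r + 1))⁻¹ * ∫ x in Aset, ∫ y in Aset, h x * Kn r x y * h y ∂μ ∂μ :=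
    conductance_arith (inv_mul_gap_arith hL0n hvar)
  -- (1) the slice-chain probabilities and their limits
  set f : GaugeConfig 3 (2 * S + 1) G → ℝ := Aset.indicator (fun _ => (1 : ℝ)) with hf
  have hfm : Measurable f := measurable_const.indicator hAset
  have hf01 : ∀ x, f x = 0 ∨ f x = 1 := fun x => by
    by_cases hx : x ∈ Aset
    · right; simp [hf, hx]
    · left; simp [hf, hx]
  have hfb : ∀ x, ‖f x‖ ≤ 1 := fun x => by rcases hf01 x with h0 | h0 <;> simp [h0]
  have hone : ∀ x : GaugeConfig 3 (2 * S + 1) G, ‖(fun _ : GaugeConfig 3 (2 * S + 1) G => (1 : ℝ)) x‖ ≤ 1 := fun x => by simp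
  have hX1m := stronglyMeasurable_fgKernel hK hfm (measurable_const : Measurable fun _ : GaugeConfig 3 (2 * S + 1) G => (1 : ℝ))
  have hX1b := norm_fgKernel_le hC hfb hone
  obtain ⟨X1, hX1⟩ := exists_kernelOp (μ := μ) hX1m hX1b
  have hXnm := stronglyMeasurable_lagKernel (μ := μ) hKm hC hK0 hKs hfm hfm r
  have hXnb := norm_lagKernel_le (μ := μ) hKm hC hK0 hKs hfb hfb r
  obtain ⟨Xn, hXn⟩ := exists_kernelOp (μ := μ) hXnm hXnb
  set πc : s → ℝ := fun i => ∫ x, f x * (b i x) ^ 2 ∂μ with hπc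
  set qc : s → ℝ := fun i => ⟪b i, Xn (b i)⟫ with hqc
  have hπb : ∀ i, |πc i| ≤ 1 := by
    intro i
    have hsq : Integrable (fun x => (b i x) ^ 2) μ := (Lp.memLp (b i)).integrable_sq
    have h1 : ∫ x, (b i x) ^ 2 ∂μ = 1 := by
      have := inner_eq_integral (μ := μ) (b i) (b i)
      rw [real_inner_self_eq_norm_sq, b.orthonormal.norm_eq_one i, one_pow] at this
      rw [this]; refine integral_congr_ae (Eventually.of_forall fun x => ?_); ring
    have hnn : 0 ≤ πc i := integral_nonneg fun x => by
      rcases hf01 x with h0 | h0 <;> simp [h0, sq_nonneg]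
    have hle1 : πc i ≤ 1 := by
      rw [← h1]
      refine integral_mono_of_nonneg (Eventually.of_forall fun x => ?_) hsq (Eventually.of_forall fun x => ?_)
      · rcases hf01 x with h0 | h0 <;> simp [h0, sq_nonneg]
      · rcases hf01 x with h0 | h0 <;> simp [h0, sq_nonneg]
    rw [abs_of_nonneg hnn]; exact hle1
  have hqb : ∀ i, |qc i| ≤ ‖Xn‖ := fun i => by
    calc |qc i| ≤ ‖b i‖ * ‖Xn (b i)‖ := abs_real_inner_le_norm _ _
      _ ≤ ‖b i‖ * (‖Xn‖ * ‖b i‖) := mul_le_mul_of_nonneg_left (Xn.le_opNorm _) (norm_nonneg _)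
      _ = ‖Xn‖ := by rw [b.orthonormal.norm_eq_one i]; ring
  have hmass : ∀ M : ℕ, sliceMass ρ β (2 * S + 1) (M + 1 + 2) Aset =
      (∑' i, rr i ^ (M + 1 + 2) * πc i) / (∑' i, rr i ^ (M + 1 + 2)) := by
    intro M
    have hS := hasSum_cyclic_insert_fg (μ := μ) hK hC hsymm hAker hb hfm
      (measurable_const : Measurable fun _ : GaugeConfig 3 (2 * S + 1) G => (1 : ℝ)) hfb hone hX1 M
    have hcoef : ∀ i, lam i ^ (M + 2) * ⟪b i, X1 (b i)⟫ = lam i ^ (M + 1 + 2) * πc i := by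
      intro i
      rw [inner_fgOp_one_eq (μ := μ) hAker hb hX1 i]
      ring
    simp_rw [hcoef, mul_one] at hS
    unfold sliceMass
    rw [cyclicExpectation_eq]
    exact ratio_eq_of_hasSum hL0.ne' hlamr (M + 1 + 2) hS (hZ (M + 1))
  have hstay : ∀ M : ℕ, sliceStayN ρ β (2 * S + 1) (M + r + 1 + 2) (r + 1) Aset =
      (lam₀ ^ (r + 1))⁻¹ * ((∑' i, rr i ^ (M + 2) * qc i) / (∑' i, rr i ^ (M + 2 + (r + 1)))) := by
    intro M
    set q : Fin (M + r + 1 + 2) := ((r + 1 : ℕ) : ZMod (M + r + 1 + 2)) with hq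
    have hqv : (q : ℕ) = r + 1 := by
      have h1 : ZMod.val (((r + 1 : ℕ) : ZMod (M + r + 1 + 2))) = (r + 1) % (M + r + 1 + 2) :=
        ZMod.val_natCast _ (r + 1)
      rw [Nat.mod_eq_of_lt (by omega)] at h1
      exact h1
    have hc' : M + 1 + 1 + r + 1 = M + r + 1 + 2 := by omega
    set p : Fin (M + 1 + 1 + r + 1) := Fin.cast hc'.symm q with hp
    have hpv : (p : ℕ) = r + 1 := by rw [hp, Fin.val_cast, hqv]
    have hS := hasSum_cyclic_insert_lag (μ := μ) hK hC hsymm hAker hb hK0 hKs hfm hfm hfb hfb r hXn M p hpv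
    have hcast := integral_cyclic_cast_lag μ hc' K f f p
    have hpq : Fin.cast hc' p = q := by rw [hp]; exact Fin.ext rfl
    rw [hpq] at hcast
    rw [← hcast] at hS
    have hdef : sliceStayN ρ β (2 * S + 1) (M + r + 1 + 2) (r + 1) Aset =
        (∫ V : Fin (M + r + 1 + 2) → GaugeConfig 3 (2 * S + 1) G, (∏ t, K (V t) (V (t + 1))) * (f (V 0) * f (V q))
          ∂(Measure.pi fun _ => μ)) / cyclicPartition ρ β (2 * S + 1) (M + r + 1 + 2) := rfl
    have hre' : (∫ V : Fin (M + r + 1 + 2) → GaugeConfig 3 (2 * S + 1) G, (∏ t, K (V t) (V (t + 1))) *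
          (f (V 0) * f (V q)) ∂(Measure.pi fun _ => μ)) =
        ∫ V : Fin (M + r + 1 + 2) → GaugeConfig 3 (2 * S + 1) G, f (V 0) * f (V q) * ∏ t, K (V t) (V (t + 1))
          ∂(Measure.pi fun _ => μ) := by
      refine integral_congr_ae (Eventually.of_forall fun V => ?_)
      ring
    rw [hdef, hre']
    have hZ' : HasSum (fun i => lam i ^ (M + 2 + (r + 1))) (cyclicPartition ρ β (2 * S + 1) (M + r + 1 + 2)) := by
      have e : (fun i : s => lam i ^ (M + 2 + (r + 1))) = fun i => lam i ^ (M + r + 1 + 2) :=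
        funext fun i => by congr 1
      rw [e]
      exact hZ (M + r + 1)
    exact ratio_eq_of_hasSum_add hL0.ne' hlamr (M + 2) (r + 1) hS hZ'
  have hTπ : Tendsto (fun M : ℕ => ∑' i, rr i ^ (M + 1 + 2) * πc i) atTop (𝓝 (πc i₀)) :=
    (tendsto_tsum_pow_mul hr0 hri₀ hϑ1 hrϑ hrsum hπb).comp (tendsto_add_atTop_nat 1)
  have hT1 : Tendsto (fun M : ℕ => ∑' i, rr i ^ (M + 1 + 2)) atTop (𝓝 1) := by
    have h1 := (tendsto_tsum_pow_mul (c := fun _ => (1 : ℝ)) (B := 1) hr0 hri₀ hϑ1 hrϑ hrsum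
      (fun _ => by simp)).comp (tendsto_add_atTop_nat 1)
    refine h1.congr fun M => ?_
    simp only [Function.comp_apply, mul_one]
  have hT1r : Tendsto (fun M : ℕ => ∑' i, rr i ^ (M + 2 + (r + 1))) atTop (𝓝 1) := by
    have h1 := (tendsto_tsum_pow_mul (c := fun _ => (1 : ℝ)) (B := 1) hr0 hri₀ hϑ1 hrϑ hrsum
      (fun _ => by simp)).comp (tendsto_add_atTop_nat (r + 1))
    refine h1.congr fun M => ?_
    simp only [Function.comp_apply, mul_one]
    refine tsum_congr fun i => ?_
    congr 1; omega
  have hTq : Tendsto (fun M : ℕ => ∑' i, rr i ^ (M + 2) * qc i) atTop (𝓝 (qc i₀)) :=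
    tendsto_tsum_pow_mul hr0 hri₀ hϑ1 hrϑ hrsum hqb
  have hTmass : Tendsto (fun M : ℕ => sliceMass ρ β (2 * S + 1) (M + 1 + 2) Aset) atTop (𝓝 (πc i₀)) := by
    have := hTπ.div hT1 one_ne_zero
    rw [div_one] at this
    exact this.congr fun M => (hmass M).symm
  have hTmass' : Tendsto (fun M : ℕ => sliceMass ρ β (2 * S + 1) (M + r + 1 + 2) Aset) atTop (𝓝 (πc i₀)) := by
    have := hTmass.comp (tendsto_add_atTop_nat r)
    refine this.congr fun M => ?_
    simp only [Function.comp_apply]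
  have hTstay : Tendsto (fun M : ℕ => sliceStayN ρ β (2 * S + 1) (M + r + 1 + 2) (r + 1) Aset) atTop
      (𝓝 ((lam₀ ^ (r + 1))⁻¹ * qc i₀)) := by
    have := (hTq.div hT1r one_ne_zero).const_mul (lam₀ ^ (r + 1))⁻¹
    rw [div_one] at this
    exact this.congr fun M => (hstay M).symm
  -- identification of the limits with the ground state
  have hπ₀ : πc i₀ = ∫ x in Aset, h x ^ 2 ∂μ := by
    have h1 : πc i₀ = ∫ x, f x * h x ^ 2 ∂μ := by
      refine integral_congr_ae ?_
      filter_upwards [hbε] with x hx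
      rw [hx, mul_pow, hε2, one_mul]
    rw [h1, ← integral_indicator hAset]
    refine integral_congr_ae (Eventually.of_forall fun x => ?_)
    rcases hf01 x with h0 | h0
    · have hx : x ∉ Aset := by
        intro hx; simp [hf, hx] at h0
      simp [h0, hx]
    · have hx : x ∈ Aset := by
        by_contra hx; simp [hf, hx] at h0
      simp [h0, hx]
  have hq₀ : qc i₀ = ∫ x in Aset, ∫ y in Aset, h x * Kn r x y * h y ∂μ ∂μ := by
    have h1 : qc i₀ = ∫ x, f x * b i₀ x * ∫ y, Kn r x y * (f y * b i₀ y) ∂μ ∂μ :=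
      inner_lagOp_eq (μ := μ) (b := b) hXn i₀
    have h2 : ∀ x, ∫ y, Kn r x y * (f y * b i₀ y) ∂μ = ∫ y, Kn r x y * (f y * (ε * h y)) ∂μ := fun x =>
      integral_congr_ae (by filter_upwards [hbε] with y hy; rw [hy])
    rw [h1]
    simp_rw [h2]
    have h3 : ∫ x, f x * b i₀ x * ∫ y, Kn r x y * (f y * (ε * h y)) ∂μ ∂μ =
        ∫ x, f x * (ε * h x) * ∫ y, Kn r x y * (f y * (ε * h y)) ∂μ ∂μ :=
      integral_congr_ae (by filter_upwards [hbε] with x hx; rw [hx])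
    rw [h3, ← integral_indicator hAset]
    refine integral_congr_ae (Eventually.of_forall fun x => ?_)
    have hin : ∫ y, Kn r x y * (f y * (ε * h y)) ∂μ = ε * ∫ y in Aset, Kn r x y * h y ∂μ := by
      rw [← integral_indicator hAset, ← integral_const_mul]
      refine integral_congr_ae (Eventually.of_forall fun y => ?_)
      by_cases hy : y ∈ Aset
      · simp [hf, hy]; ring
      · simp [hf, hy]
    dsimp only
    rw [hin]
    by_cases hx : x ∈ Aset
    · simp only [hf, hx, Set.indicator_of_mem, one_mul]
      have : ε * h x * (ε * ∫ y in Aset, Kn r x y * h y ∂μ) = ε ^ 2 * (h x * ∫ y in Aset, Kn r x y * h y ∂μ) := by ring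
      rw [this, hε2, one_mul, ← integral_const_mul]
      refine integral_congr_ae (Eventually.of_forall fun y => ?_); ring
    · simp [hf, hx]
  -- the limit quantities `P`, `Q`
  obtain ⟨P, hPdef⟩ : ∃ P : ℝ, P = ∫ x in Aset, h x ^ 2 ∂μ := ⟨_, rfl⟩
  rw [hπ₀, ← hPdef] at hTmass'
  rw [hq₀] at hTstay
  rw [← hPdef] at hcond0
  -- `h² ≥ h₀² > 0`: a set of vanishing `∫ h²` is Haar-null
  have hh2m : Measurable fun x => h x ^ 2 := hhm.pow_const 2
  have hh2b : ∀ x, ‖h x ^ 2‖ ≤ B ^ 2 := fun x => by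
    rw [Real.norm_eq_abs, abs_of_nonneg (sq_nonneg _)]
    have := hhB x
    rw [Real.norm_eq_abs] at this
    calc h x ^ 2 = |h x| ^ 2 := (sq_abs _).symm
      _ ≤ B ^ 2 := pow_le_pow_left₀ (abs_nonneg _) this 2
  have hh2i : Integrable (fun x => h x ^ 2) μ := integrable_of_bdd hh2m hh2b
  have hnull : ∀ E : Set (GaugeConfig 3 (2 * S + 1) G), MeasurableSet E → ∫ x in E, h x ^ 2 ∂μ = 0 → μ E = 0 := by
    intro E hE hI
    have h1 : ∫ x in E, h₀ ^ 2 ∂μ ≤ ∫ x in E, h x ^ 2 ∂μ :=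
      setIntegral_mono_on (integrable_const _).integrableOn hh2i.integrableOn hE fun x _ =>
        pow_le_pow_left₀ hh₀.le (hlow x) 2
    rw [setIntegral_const, smul_eq_mul, hI] at h1
    have h2 : μ.real E ≤ 0 := by
      by_contra hcon
      exact absurd h1 (not_le.2 (mul_pos (lt_of_not_ge hcon) (pow_pos hh₀ 2)))
    exact (measureReal_eq_zero_iff (measure_ne_top μ E)).1 (le_antisymm h2 measureReal_nonneg)
  have hP0 : 0 ≤ P := by rw [hPdef]; exact setIntegral_nonneg hAset fun x _ => sq_nonneg _
  have hP1 : P ≤ 1 := by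
    have := hπb i₀
    rw [hπ₀, ← hPdef] at this
    exact (le_abs_self _).trans this
  rcases hP0.eq_or_lt with hPz | hPpos
  · -- `P = 0`: `A` is null, `mass_m(A) = stay_m(A) = 0`
    have hA0' : μ Aset = 0 := hnull Aset hAset (by rw [← hPdef]; exact hPz.symm)
    refine ⟨0, fun m _ => ?_⟩
    have hae : ∀ᵐ V ∂(Measure.pi fun _ : ZMod (m + 2) => μ), V 0 ∉ Aset :=
      measure_eq_zero_iff_ae_notMem.1
        ((measurePreserving_eval (fun _ : ZMod (m + 2) => μ) 0).quasiMeasurePreserving.preimage_null hA0')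
    have hm0 : sliceMass ρ β (2 * S + 1) (m + 2) Aset = 0 := by
      unfold sliceMass
      refine cyclicExpectation_eq_zero_of_ae (ρ := ρ) β (2 * S + 1) (m + 2) ?_
      filter_upwards [hae] with V hV
      exact Set.indicator_of_notMem hV _
    have hs0 : sliceStayN ρ β (2 * S + 1) (m + 2) (r + 1) Aset = 0 := by
      unfold sliceStayN
      refine cyclicExpectation_eq_zero_of_ae (ρ := ρ) β (2 * S + 1) (m + 2) ?_
      filter_upwards [hae] with V hV
      rw [Set.indicator_of_notMem hV, zero_mul]
    rw [hm0, hs0]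
    norm_num
  rcases hP1.eq_or_lt with hPo | hPlt
  · -- `P = 1`: `Aᶜ` is null, `mass_m(A) = stay_m(A) = 1`
    have hAc : μ Asetᶜ = 0 := by
      refine hnull Asetᶜ hAset.compl ?_
      rw [setIntegral_compl hAset hh2i, hnorm, ← hPdef, hPo, sub_self]
    refine ⟨0, fun m _ => ?_⟩
    have hae0 : ∀ᵐ V ∂(Measure.pi fun _ : ZMod (m + 2) => μ), V 0 ∉ Asetᶜ :=
      measure_eq_zero_iff_ae_notMem.1
        ((measurePreserving_eval (fun _ : ZMod (m + 2) => μ) 0).quasiMeasurePreserving.preimage_null hAc)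
    have hae1 : ∀ᵐ V ∂(Measure.pi fun _ : ZMod (m + 2) => μ), V ((r + 1 : ℕ) : ZMod (m + 2)) ∉ Asetᶜ :=
      measure_eq_zero_iff_ae_notMem.1
        ((measurePreserving_eval (fun _ : ZMod (m + 2) => μ) ((r + 1 : ℕ) : ZMod (m + 2))).quasiMeasurePreserving.preimage_null hAc)
    have hm1 : sliceMass ρ β (2 * S + 1) (m + 2) Aset = 1 := by
      unfold sliceMass
      refine cyclicExpectation_eq_one_of_ae hρ hρu β (2 * S + 1) (m + 2) ?_
      filter_upwards [hae0] with V hV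
      exact Set.indicator_of_mem (not_notMem.1 hV) _
    have hs1 : sliceStayN ρ β (2 * S + 1) (m + 2) (r + 1) Aset = 1 := by
      unfold sliceStayN
      refine cyclicExpectation_eq_one_of_ae hρ hρu β (2 * S + 1) (m + 2) ?_
      filter_upwards [hae0, hae1] with V hV hV'
      rw [Set.indicator_of_mem (not_notMem.1 hV), Set.indicator_of_mem (not_notMem.1 hV'), mul_one]
    rw [hm1, hs1]
    norm_num
  -- main case `0 < P < 1`: the limit inequality is strict
  have heer : ee ^ (r + 1) = Real.exp (-(c * ((r : ℝ) + 1))) := by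
    rw [hee, ← Real.exp_nat_mul]; congr 1; push_cast; ring
  have hlt : k * (P * (1 - P)) <
      P - (lam₀ ^ (r + 1))⁻¹ * ∫ x in Aset, ∫ y in Aset, h x * Kn r x y * h y ∂μ ∂μ := by
    have hPP : 0 < P * (1 - P) := mul_pos hPpos (by linarith)
    have h1 : k * (P * (1 - P)) < (1 - ee ^ (r + 1)) * (P * (1 - P)) := by
      rw [heer]; exact mul_lt_mul_of_pos_right hklt hPP
    refine h1.trans_le ?_
    rw [← mul_assoc]; exact hcond0
  have hev := (((hTmass'.mul (tendsto_const_nhds.sub hTmass')).const_mul k).eventually_lt (hTmass'.sub hTstay) hlt)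
  obtain ⟨M₀, hM₀⟩ := eventually_atTop.1 hev
  refine ⟨M₀ + r + 1, fun m hm => ?_⟩
  obtain ⟨M, rfl⟩ : ∃ M, m = M + r + 1 := ⟨m - r - 1, by omega⟩
  exact (hM₀ M (by omega)).le

end PerTorus

end Summit.QuantumFields.YangMills.Cruxes.IR.VacuumEscape

end
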